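import Summits.ValiantsHypothesis.ValiantsHypothesis.Theorems.DefinabilityGapAsymptotics
import Summits.ValiantsHypothesis.ValiantsHypothesis.Theorems.DefinabilityGapPhaseAExists
import HarnessLib

/-!
# Definability gap, ROAD P: the numeric lemma — Phase A holds for all large `m` (N1 v2 (5n))

The side conditions of `DefinabilityGapPhaseAExists.exists_rowRule_fewBad_clauses` are
discharged for the concrete constants of `DefinabilityGapAsymptotics` (`k = m/4+1`, `N = 32m`,
`M = (m−k)/16`, `L = m/8`, `B = 2400`) together with `p = 1/(m−k)`, `t = m/16`, `n₀ = m/2`,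
`θ₀ = e^{−128} ≤ e^{−2pN}`, `s = ⌊θ₀ n₀/65536⌋`, `t' = θ₀ s/16`, for all sufficiently large `m`
(filters: `∀ᶠ m in atTop`; no explicit `m₀` is computed — it is astronomically large).

* `pC_le`, `pN_le`, `theta0_le`, `pmM_le`, `hbudget_holds`: the budget;
* `tendsto_sC`, `sigma_le`, `hB_eventually`: the free-position threshold;
* `e1_bound` … `e4_bound`, `hsmall_eventually`: the four union bounds sum to `< 1`;
* **`exists_m0_rowRule_fewBad`**: `∃ m₀, ∀ m ≥ m₀, ∀ T` with `#T ≤ 2q+1`, some row assignment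
  obeys the row rule for `N = 32m` and satisfies clauses 2–3 of `KIPivotFewBad m T` (the
  `hcolbad`/`hrowbad` hypotheses of `kiPivotCertificate_of_fewBad`) for EVERY pivot column.
  What then remains of `KIPivotFewBadFrom` is clause 1 (injective pivots: the alteration).
-/

namespace Summit.ValiantsHypothesis.ValiantsHypothesis.Theorems.DefinabilityGapNumerics

open Filter Topology Real Finset
open Literature.Computability.AlgebraicComplexity Literature.Computability.MetaComplexity
open Summit.ValiantsHypothesis.ValiantsHypothesis.Theorems.DefinabilityGapAffineRung
open Summit.ValiantsHypothesis.ValiantsHypothesis.Theorems.DefinabilityGapPivotCertificate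
open Summit.ValiantsHypothesis.ValiantsHypothesis.Theorems.DefinabilityGapPivotLive
open Summit.ValiantsHypothesis.ValiantsHypothesis.Theorems.DefinabilityGapPivotLiveWeak
open Summit.ValiantsHypothesis.ValiantsHypothesis.Theorems.DefinabilityGapPivotLiveBad
open Summit.ValiantsHypothesis.ValiantsHypothesis.Theorems.DefinabilityGapPivotAdmissible
open Summit.ValiantsHypothesis.ValiantsHypothesis.Theorems.DefinabilityGapAsymptotics
open Summit.ValiantsHypothesis.ValiantsHypothesis.Theorems.DefinabilityGapPhaseAExists

/-! ## 1. The real constants -/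

/-- `p = 1/(m − k)`. [this file] -/
noncomputable def pC (m : ℕ) : ℝ := 1 / ((m - kC m : ℕ) : ℝ)

/-- `t = m/16`. [this file] -/
noncomputable def tC (m : ℕ) : ℝ := (m : ℝ) / 16

/-- `θ₀ = e^{−128}`, a lower bound for `e^{−2pN}`. [this file] -/
noncomputable def θ₀ : ℝ := exp (-128)

/-- `s = ⌊θ₀ n₀ / 65536⌋` with `n₀ = m/2`. [this file] -/
noncomputable def sC (m : ℕ) : ℕ := ⌊θ₀ * ((m / 2 : ℕ) : ℝ) / 65536⌋₊

/-- `t' = θ₀ s/16`. [this file] -/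
noncomputable def tpC (m : ℕ) : ℝ := θ₀ * (sC m : ℝ) / 16

/-- `θ₀ > 0`. [this file] -/
theorem theta0_pos : 0 < θ₀ := exp_pos _

/-- `θ₀ ≤ 1`. [this file] -/
theorem theta0_le_one : θ₀ ≤ 1 := by
  unfold θ₀; exact exp_le_one_iff.mpr (by norm_num)

/-! ## 2. The budget -/

/-- `p > 0`. [this file] -/
theorem pC_pos {m : ℕ} (hm : 2 ≤ m) : 0 < pC m := by
  have h : 0 < m - kC m := by have := kC_lt hm; omega
  unfold pC
  exact one_div_pos.mpr (by exact_mod_cast h)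

/-- `p ≤ 2/m`. [this file] -/
theorem pC_le {m : ℕ} (hm : 4 ≤ m) : pC m ≤ 2 / m := by
  have hk : 0 < m - kC m := by have := kC_lt (show 2 ≤ m by omega); omega
  have h2 : m ≤ 2 * (m - kC m) := by
    have := two_kC_le hm; have := kC_lt (show 2 ≤ m by omega); omega
  unfold pC
  rw [div_le_div_iff₀ (by exact_mod_cast hk) (by exact_mod_cast (show 0 < m by omega))]
  rw [one_mul]
  exact_mod_cast h2

/-- `p ≤ 1/2`. [this file] -/
theorem pC_le_half {m : ℕ} (hm : 24 ≤ m) : pC m ≤ 1 / 2 := by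
  unfold pC
  exact one_div_le_one_div_of_le (by norm_num)
    (by exact_mod_cast (show 2 ≤ m - kC m by have := sub_kC_ge hm; omega))

/-- `1/(m−k) ≤ p` (with equality). [this file] -/
theorem hAp_holds (m : ℕ) : 1 / ((m - kC m : ℕ) : ℝ) ≤ pC m := le_rfl

/-- `p N ≤ 64`. [this file] -/
theorem pN_le {m : ℕ} (hm : 4 ≤ m) : pC m * (NC m : ℝ) ≤ 64 := by
  have hm0 : (0 : ℝ) < m := by exact_mod_cast (show 0 < m by omega)
  calc pC m * (NC m : ℝ) ≤ 2 / m * (NC m : ℝ) :=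
        mul_le_mul_of_nonneg_right (pC_le hm) (Nat.cast_nonneg _)
    _ = 64 := by unfold NC; push_cast; field_simp; ring

/-- `θ₀ ≤ e^{−2pN}`. [this file] -/
theorem theta0_le {m : ℕ} (hm : 4 ≤ m) : θ₀ ≤ exp (-(2 * pC m * NC m)) := by
  unfold θ₀
  have := pN_le hm
  exact exp_le_exp.mpr (by linarith)

/-- `p m M ≤ m/16`. [this file] -/
theorem pmM_le {m : ℕ} (hm : 24 ≤ m) : pC m * ((m : ℝ) * MC m) ≤ m / 16 := by
  have hk : (0 : ℝ) < ((m - kC m : ℕ) : ℝ) := by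
    exact_mod_cast (show 0 < m - kC m by have := sub_kC_ge hm; omega)
  have h16 : pC m * (MC m : ℝ) ≤ 1 / 16 := by
    unfold pC
    rw [div_mul_eq_mul_div, one_mul, div_le_div_iff₀ hk (by norm_num)]
    have h : ((16 * MC m : ℕ) : ℝ) ≤ ((m - kC m : ℕ) : ℝ) := by exact_mod_cast sixteen_MC_le m
    push_cast at h
    linarith
  have hm0 : (0 : ℝ) ≤ m := Nat.cast_nonneg _
  calc pC m * ((m : ℝ) * MC m) = m * (pC m * MC m) := by ring
    _ ≤ m * (1 / 16) := mul_le_mul_of_nonneg_left h16 hm0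
    _ = m / 16 := by ring

/-- `t > 0` for `m ≥ 1`. [this file] -/
theorem tC_pos {m : ℕ} (hm : 1 ≤ m) : 0 < tC m := by
  unfold tC; have : (0 : ℝ) < m := by exact_mod_cast hm
  positivity

/-- THE BUDGET `2 (L + p m M + t) ≤ m` (indeed `≤ m/2`). [this file] -/
theorem hbudget_holds {m : ℕ} (hm : 24 ≤ m) :
    2 * ((LC m : ℝ) + (pC m * ((m : ℝ) * MC m) + tC m)) ≤ m := by
  have hL : (LC m : ℝ) ≤ m / 8 := by unfold LC; exact Nat.cast_div_le
  have hp := pmM_le hm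
  have hm0 : (0 : ℝ) ≤ m := Nat.cast_nonneg _
  unfold tC
  linarith

/-! ## 3. The sparse-subfamily size `s` and the free-position threshold -/

/-- `s ≤ θ₀ n₀/65536`. [this file] -/
theorem sC_real_le (m : ℕ) : (sC m : ℝ) ≤ θ₀ * ((m / 2 : ℕ) : ℝ) / 65536 :=
  Nat.floor_le (by have := theta0_pos; positivity)

/-- `s ≥ θ₀ n₀/65536 − 1`. [this file] -/
theorem sC_real_ge (m : ℕ) : θ₀ * ((m / 2 : ℕ) : ℝ) / 65536 - 1 ≤ (sC m : ℝ) :=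
  (Nat.sub_one_lt_floor _).le

/-- `s ≤ n₀`. [this file] -/
theorem sC_le (m : ℕ) : sC m ≤ m / 2 := by
  have h1 := sC_real_le m
  have h2 : θ₀ * ((m / 2 : ℕ) : ℝ) / 65536 ≤ ((m / 2 : ℕ) : ℝ) := by
    have h0 : (0 : ℝ) ≤ ((m / 2 : ℕ) : ℝ) := Nat.cast_nonneg _
    have := theta0_le_one
    have := theta0_pos
    nlinarith
  exact_mod_cast h1.trans h2

/-- `s ≥ θ₀ m / 131072 − 2`. [this file] -/
theorem sC_ge_linear (m : ℕ) : θ₀ / 131072 * (m : ℝ) + -(θ₀ / 65536 + 1) ≤ (sC m : ℝ) := by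
  have h1 := sC_real_ge m
  have h2 : (m : ℝ) ≤ 2 * ((m / 2 : ℕ) : ℝ) + 1 := by
    exact_mod_cast (show m ≤ 2 * (m / 2) + 1 by omega)
  have := theta0_pos
  nlinarith

/-- `s → ∞`. [this file] -/
theorem tendsto_sC : Tendsto (fun m : ℕ => (sC m : ℝ)) atTop atTop := by
  have hθ : 0 < θ₀ / 131072 := by have := theta0_pos; positivity
  have hg : Tendsto (fun m : ℕ => θ₀ / 131072 * (m : ℝ) + -(θ₀ / 65536 + 1)) atTop atTop :=
    tendsto_atTop_add_const_right atTop _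
      (Tendsto.const_mul_atTop hθ tendsto_natCast_atTop_atTop)
  exact tendsto_atTop_mono (fun m => sC_ge_linear m) hg

/-- Eventually `2 ≤ s`. [this file] -/
theorem eventually_two_le_sC : ∀ᶠ m : ℕ in atTop, 2 ≤ sC m := by
  filter_upwards [tendsto_sC.eventually_ge_atTop (2 : ℝ)] with m hm
  exact_mod_cast hm

/-- The uniform sparse load `σ₀ = 4pNs²/n₀ ≤ θ₀ s/256` (for `m ≥ 4`). [this file] -/
theorem sigma_le {m : ℕ} (hm : 4 ≤ m) :
    4 * pC m * NC m * (sC m : ℝ) ^ 2 / ((m / 2 : ℕ) : ℝ) ≤ θ₀ * sC m / 256 := by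
  have hn0 : (0 : ℝ) < ((m / 2 : ℕ) : ℝ) := by exact_mod_cast (show 0 < m / 2 by omega)
  have hpN := pN_le hm
  have hs0 : (0 : ℝ) ≤ sC m := Nat.cast_nonneg _
  have hs2 : (sC m : ℝ) ^ 2 ≤ sC m * (θ₀ * ((m / 2 : ℕ) : ℝ) / 65536) := by
    rw [sq]; exact mul_le_mul_of_nonneg_left (sC_real_le m) hs0
  have h1 : 4 * pC m * NC m * (sC m : ℝ) ^ 2 ≤ 4 * 64 * (sC m : ℝ) ^ 2 := by
    have := mul_nonneg (sub_nonneg.mpr hpN) (sq_nonneg (sC m : ℝ))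
    nlinarith
  have h2 : 4 * 64 * (sC m : ℝ) ^ 2 ≤ 4 * 64 * (sC m * (θ₀ * ((m / 2 : ℕ) : ℝ) / 65536)) := by
    linarith
  calc 4 * pC m * NC m * (sC m : ℝ) ^ 2 / ((m / 2 : ℕ) : ℝ)
      ≤ 4 * 64 * (sC m * (θ₀ * ((m / 2 : ℕ) : ℝ) / 65536)) / ((m / 2 : ℕ) : ℝ) :=
        div_le_div_of_nonneg_right (h1.trans h2) hn0.le
    _ = θ₀ * sC m / 256 := by field_simp; ring

/-- `t' > 0` once `s ≥ 1`. [this file] -/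
theorem tpC_pos {m : ℕ} (hs : 1 ≤ sC m) : 0 < tpC m := by
  unfold tpC
  have := theta0_pos
  have : (0 : ℝ) < sC m := by exact_mod_cast hs
  positivity

/-- THE FREE-POSITION THRESHOLD, eventually:
`B ≤ e^{−2pN} s/2 − 2(4pNs²/n₀ + t')`. [this file] -/
theorem hB_eventually : ∀ᶠ m : ℕ in atTop, (BC : ℝ) ≤
    exp (-(2 * pC m * NC m)) * sC m / 2 -
      2 * (4 * pC m * NC m * (sC m : ℝ) ^ 2 / ((m / 2 : ℕ) : ℝ) + tpC m) := by
  have hc : 0 < θ₀ * 47 / 128 := by have := theta0_pos; positivity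
  filter_upwards [eventually_ge_atTop 4,
    (tendsto_sC.const_mul_atTop hc).eventually_ge_atTop ((BC : ℕ) : ℝ)] with m hm hbig
  have hθ := theta0_le hm
  have hσ := sigma_le hm
  have hs0 : (0 : ℝ) ≤ sC m := Nat.cast_nonneg _
  have h1 : θ₀ * sC m / 2 ≤ exp (-(2 * pC m * NC m)) * sC m / 2 := by
    have := mul_le_mul_of_nonneg_right hθ hs0
    linarith
  unfold tpC
  linarith

/-! ## 4. The four union bounds -/

/-- Row over-load exponent: `e₁ ≤ e^{−3m/256}`. [this file] -/
theorem e1_bound {m X : ℝ} (hm : 0 < m) (hX0 : 0 ≤ X) (hX : X ≤ m / 16) :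
    exp (-((m / 16) ^ 2 / (2 * (2 * X + 2 * (m / 16) / 3)))) ≤ exp (-(3 * m / 256)) := by
  refine exp_le_exp.mpr (neg_le_neg ?_)
  rw [le_div_iff₀ (by positivity)]
  nlinarith [mul_nonneg hm.le (sub_nonneg.mpr hX)]

/-- Column over-load exponent: `e₂ ≤ e^{−3m/256}`. [this file] -/
theorem e2_bound {m X : ℝ} (hm : 0 < m) (hX0 : 0 ≤ X) (hX : X ≤ m / 16) :
    exp (-((m / 16) ^ 2 / (2 * (X + 1 * (m / 16) / 3)))) ≤ exp (-(3 * m / 256)) := by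
  refine exp_le_exp.mpr (neg_le_neg ?_)
  rw [le_div_iff₀ (by positivity)]
  nlinarith [mul_nonneg hm.le (sub_nonneg.mpr hX)]

/-- Few privately-free cells exponent: `e₃ ≤ e^{−θ₀ s/13}`. [this file] -/
theorem e3_bound {θ E s : ℝ} (hθ0 : 0 ≤ θ) (hθ : θ ≤ E) (hs : 0 ≤ s) :
    exp (-(E * s / 8)) ≤ exp (-(θ * s / 13)) := by
  refine exp_le_exp.mpr (neg_le_neg ?_)
  have := mul_le_mul_of_nonneg_right hθ hs
  nlinarith

/-- Active shared killers exponent: `e₄ ≤ e^{−θ s/13}` (`σ ≤ θ s/256`, `t' = θ s/16`).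
[this file] -/
theorem e4_bound {θ s σ : ℝ} (hθs : 0 < θ * s) (hσ0 : 0 ≤ σ) (hσ : σ ≤ θ * s / 256) :
    exp (-((θ * s / 16) ^ 2 / (2 * (σ + 1 * (θ * s / 16) / 3)))) ≤ exp (-(θ * s / 13)) := by
  refine exp_le_exp.mpr (neg_le_neg ?_)
  rw [le_div_iff₀ (by positivity)]
  have h := mul_le_mul_of_nonneg_left hσ (show (0 : ℝ) ≤ 2 * (θ * s) / 13 by positivity)
  nlinarith [sq_nonneg (θ * s)]

/-- The union-bound expression of `exists_rowRule_fewBad_clauses` for our constants, as a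
function of the family size `Tc`. [this file] -/
noncomputable def smallExpr (m : ℕ) (Tc : ℝ) : ℝ :=
  Tc * m * exp (-(tC m ^ 2 / (2 * (2 * (pC m * ((m : ℝ) * MC m)) + 2 * tC m / 3))))
    + Tc * m * exp (-(tC m ^ 2 / (2 * (pC m * ((m : ℝ) * MC m) + 1 * tC m / 3))))
    + 2 * (Tc * m * (exp (-(exp (-(2 * pC m * NC m)) * sC m / 8)) +
        exp (-(tpC m ^ 2 / (2 * (4 * pC m * NC m * (sC m : ℝ) ^ 2 / ((m / 2 : ℕ) : ℝ) +
          1 * tpC m / 3))))))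

/-- Pointwise bound of the union-bound expression by two decaying exponentials
(`m ≥ 24`, `s ≥ 1`, `0 ≤ Tc ≤ 5 m²`). [this file] -/
theorem smallExpr_le {m : ℕ} (hm : 24 ≤ m) (hs : 1 ≤ sC m) {Tc : ℝ} (hT0 : 0 ≤ Tc)
    (hT : Tc ≤ 5 * (m : ℝ) ^ 2) :
    smallExpr m Tc ≤ 10 * (m : ℝ) ^ 3 * exp (-(3 / 256 * m)) +
      20 * (m : ℝ) ^ 3 * exp (-(θ₀ / 13 * sC m)) := by
  have hm0 : (0 : ℝ) < m := by exact_mod_cast (show 0 < m by omega)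
  have hX0 : 0 ≤ pC m * ((m : ℝ) * MC m) :=
    mul_nonneg (pC_pos (by omega)).le (by positivity)
  have hX := pmM_le hm
  have hs0 : (0 : ℝ) < sC m := by exact_mod_cast hs
  have hθs : 0 < θ₀ * sC m := mul_pos theta0_pos hs0
  have h1 := e1_bound hm0 hX0 hX
  have h2 := e2_bound hm0 hX0 hX
  have h3 := e3_bound theta0_pos.le (theta0_le (m := m) (by omega)) hs0.le
  have hσ := sigma_le (m := m) (by omega)
  have h4 := e4_bound hθs (by have := (pC_pos (show 2 ≤ m by omega)).le; positivity) hσ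
  have hA : exp (-(3 * (m : ℝ) / 256)) = exp (-(3 / 256 * (m : ℝ))) := by congr 1; ring
  have hD : exp (-(θ₀ * sC m / 13)) = exp (-(θ₀ / 13 * (sC m : ℝ))) := by congr 1; ring
  rw [hA] at h1 h2
  rw [hD] at h3 h4
  have hTm : Tc * m ≤ 5 * (m : ℝ) ^ 3 := by nlinarith
  have hTm0 : 0 ≤ Tc * m := by positivity
  set A := exp (-(3 / 256 * (m : ℝ))) with hA_def
  set D := exp (-(θ₀ / 13 * (sC m : ℝ))) with hD_def
  have hApos : 0 ≤ A := (exp_pos _).le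
  have hDpos : 0 ≤ D := (exp_pos _).le
  have i1 := mul_le_mul_of_nonneg_left h1 hTm0
  have i2 := mul_le_mul_of_nonneg_left h2 hTm0
  have i34 := mul_le_mul_of_nonneg_left (add_le_add h3 h4) hTm0
  have i5 := mul_le_mul_of_nonneg_right hTm hApos
  have i6 := mul_le_mul_of_nonneg_right hTm hDpos
  unfold smallExpr tC tpC
  linarith

/-- THE UNION BOUNDS SUM TO `< 1`, eventually, for every family size `≤ 4m² + 5`. [this file] -/
theorem hsmall_eventually : ∀ᶠ m : ℕ in atTop, ∀ Tc : ℝ, 0 ≤ Tc → Tc ≤ 4 * (m : ℝ) ^ 2 + 5 →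
    smallExpr m Tc < 1 := by
  have ha1 : (0 : ℝ) < 3 / 256 := by norm_num
  have ha2 : 0 < θ₀ / 13 * (θ₀ / 131072) := by have := theta0_pos; positivity
  filter_upwards [eventually_ge_atTop 24, eventually_two_le_sC,
    eventually_const_mul_pow_mul_exp_neg_lt 3 ha1 10 (show (0 : ℝ) < 1 / 2 by norm_num),
    eventually_const_mul_pow_mul_exp_sub_lt 3 ha2 20 (θ₀ / 13 * (θ₀ / 65536 + 1))
      (show (0 : ℝ) < 1 / 2 by norm_num)] with m hm hs hE1 hE2 Tc hT0 hT
  have hm3 : (3 : ℝ) ≤ m := by exact_mod_cast (show 3 ≤ m by omega)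
  have hT5 : Tc ≤ 5 * (m : ℝ) ^ 2 := by nlinarith
  have hle := smallExpr_le hm (by omega) hT0 hT5
  have hD : 20 * (m : ℝ) ^ 3 * exp (-(θ₀ / 13 * sC m)) ≤
      20 * (m : ℝ) ^ 3 * exp (θ₀ / 13 * (θ₀ / 65536 + 1) - θ₀ / 13 * (θ₀ / 131072) * m) := by
    gcongr
    have h := sC_ge_linear m
    have hθ : 0 ≤ θ₀ / 13 := by have := theta0_pos; positivity
    have := mul_le_mul_of_nonneg_left h hθ
    linarith
  linarith

/-! ## 5. The numeric lemma -/

open scoped Classical in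
/-- **PHASE A FOR ALL LARGE `m`.**  There is `m₀` such that for every `m ≥ m₀` and every family
`T` of at most `2q + 1` curves some row assignment `r` obeys the row rule for `N = 32 m` and
satisfies clauses 2–3 of `KIPivotFewBad m T` for every pivot column `s₀`. [this file] -/
theorem exists_m0_rowRule_fewBad : ∃ m₀ : ℕ, ∀ m : ℕ, m₀ ≤ m →
    ∀ T : Finset (Fin 3 → Fin (qOf m)), T.card ≤ 2 * qOf m + 1 →
      ∃ r : (Fin 3 → Fin (qOf m)) → Fin m, (∀ c, r c ∉ heavyRows T c (NC m)) ∧ ∀ s₀ : Fin m,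
        (∀ c ∈ T, ∀ j ∈ badCols (pivotZeros m T s₀ r) c (r c) s₀,
            (badCols (pivotZeros m T s₀ r) c (r c) s₀).card ≤
              (okRows (pivotZeros m T s₀ r) c (r c) j).card) ∧
          (∀ c ∈ T, ∀ i ∈ badRows (pivotZeros m T s₀ r) c (r c) s₀,
            (badRows (pivotZeros m T s₀ r) c (r c) s₀).card +
              (deadCols (pivotZeros m T s₀ r) c s₀ i).card + 1 ≤ m) := by
  obtain ⟨m₀, hm₀⟩ := eventually_atTop.mp
    ((eventually_ge_atTop 4800).and (eventually_two_le_sC.and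
      (hB_eventually.and hsmall_eventually)))
  refine ⟨m₀, fun m hm T hT => ?_⟩
  obtain ⟨hm4800, hs, hB, hsmall⟩ := hm₀ m hm
  have hT2 : 2 * T.card ≤ 2 * (2 * qOf m + 1) := by omega
  have hTc : (T.card : ℝ) ≤ 4 * (m : ℝ) ^ 2 + 5 := by
    have h := card_bound m
    have : ((2 * T.card : ℕ) : ℝ) ≤ ((8 * (m * m) + 10 : ℕ) : ℝ) := by exact_mod_cast hT2.trans h
    push_cast at this
    nlinarith
  exact exists_rowRule_fewBad_clauses T (N := NC m) (k := kC m)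
    (by unfold NC; omega) (hT2.trans (hk_holds (by omega))) (kC_lt (by omega))
    (pC_pos (by omega)) (pC_le_half (by omega)) (hAp_holds m) (MC_pos (by omega))
    (tC_pos (by omega)) (hbudget_holds (by omega)) hs (sC_le m)
    (hn₀_holds hm4800) (hT2.trans (hMLB_holds (by omega))) (tpC_pos (by omega)) hB
    (hsmall T.card (Nat.cast_nonneg _) hTc)

end Summit.ValiantsHypothesis.ValiantsHypothesis.Theorems.DefinabilityGapNumerics
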